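/-
Copyright (c) 2026 the pub-hodgecm-mathlib formalisation cell (harness21).  Prover seat hodgecm-mathlib-K2E3-p17 (g0),
Track B «K2-LIT» ∕ h413, unit U5Kazhdan of the line `K2_E3_EllipticInputs`, socket #17 `sig_K2E3PseudoCoeffExistsElliptic`
(`Cruxes/H413/Lines/K2_E3_EllipticInputsSigs_U5Kazhdan.lean` 87d8b4c974a167d7 :275–373): THE `{St_G(ψ), ψ∘det_G}` PART AT ANY
NON-SPLIT PLACE FROM AN EULER–POINCARÉ FUNCTION BY SHAPE (junction «#17 at kind 2 ⟸ #21»).  2026-09-03.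
-/
import Summits.HodgeConjecture.HodgeConjecture.Theorems.F0P3cStCharTSEPPseudoCoeffStLetters   -- ★ (G5) FILE B: `exists_isPseudoCoeff_detG_of_epFunction`, `exists_isPseudoCoeff_stG_of_epFunction`
import Summits.HodgeConjecture.HodgeConjecture.Theorems.F0P3cStCharTSPs2Kind2                  -- ★ «PS2-KIND2★» `ps2_kind2_stChar` (`Tr ψ∘det_G + Tr St_G(ψ) = Tr i_G(χ_St(ψ))`), ★ `continuous_stFst`
import Summits.HodgeConjecture.HodgeConjecture.Theorems.F0P3cStCharTSOpp23                     -- ★ «OPP-23★» (the proof pattern; brings ★ LdsOpp engine, ★ CasselmanCap, ★ `totallyDisconnectedSpace_cmDatum_local`)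
import Summits.HodgeConjecture.HodgeConjecture.Theorems.F0P3cStCharTSEllOpen                   -- ★ ELL-OPEN `isOpen_setOf_isRegularElt_and_not_mem_hyperbolicSet`
import Summits.HodgeConjecture.HodgeConjecture.Theorems.F0P2oU1DisjointOfTower                 -- ★ `continuous_units_of_coe`
import HarnessLib

/-!
# K2_E3 road (h413 = stmt-HodgeConjecture-24833), unit U5Kazhdan, socket #17 `sig_K2E3PseudoCoeffExistsElliptic` — THE KIND-2 PART
# «`St_G(ψ)`, `ψ∘det_G` have pseudo-coefficients» AT ANY NON-SPLIT PLACE, FROM AN EULER–POINCARÉ FUNCTION BY SHAPE (junction with #21)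

Cell `pub/hodgecm-mathlib` (D-0151), Track B (21-frontier RULING «PUSH BOTH» 2026-09-03), socket module
`Summits/HodgeConjecture/HodgeConjecture/Cruxes/H413/Lines/K2_E3_EllipticInputsSigs_U5Kazhdan.lean` (87d8b4c974a167d7), socket **`sig_K2E3PseudoCoeffExistsElliptic`**
(SIGS-TABLE-K2E3 row #17, XL).  ★ `K2E3PseudoCoeffExistsEllipticNotWild` (p854976) pays it at every NOT-WILD place and reduces it, at ANY place, to the
non-supercuspidal head; what is left is the WILD place `v ∣ 2` ramified in `L`.  THIS FILE pays, at ANY non-split place carrying an Euler–Poincaré function BY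
SHAPE (`hEP` = the eight clauses concluding ★ (G3) `exists_epFunction_G`, ★ (G3)-RAM `exists_epFunction_G_of_ramified` and the WILD socket #21
`sig_K2E3EPFunctionGWild` of `…Sigs_U5EPU6HSide.lean`, token for token), the KIND-2 classes `ψ∘det_G` and `St_G(ψ)` [Rogawski1990, §12.2 (1) p. 173]: so at a wild
place the residue of #17 is `{π²(ξ), πⁿ(ξ)}` and the l.d.s. members, once #21 lands.
THE MATHEMATICS.  `ψ∘det_G`: `χ = ψ∘det` is a class function, so `f := \overline{ψ∘det}·f_EP` has `Φ(γ, f) = \overline{ψ(det γ)}·Φ(γ, f_EP)` = `\overline{χ(γ)}` on `G^e`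
and `0` on `G^r − G^e` (★ FILE B `exists_isPseudoCoeff_detG_of_epFunction`).  `St_G(ψ)`: `χ_{St} = −ψ∘det` on `G^e` (print: «observe that `χ_π = −χ_{π′}` on `G^e`»,
Prop. 12.6.1 (c) p. 188), whence `−f` works (★ FILE B `exists_isPseudoCoeff_stG_of_epFunction`, which takes that relation as `hOpp`).  §1 DERIVES `hOpp` for the kind-2
pair from the JH letter «`JH(i_G(χ_St(ψ))) = {St_G(ψ), ψ∘det_G}`, two distinct classes» ALONE (the shape of the organ's pin `eSt` ∕ `hSt`): ★ `ps2_kind2_stChar` gives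
`Tr ψ∘det_G(φ) + Tr St_G(ψ)(φ) = Tr i_G(χ)(φ)`; at `φ = 𝟙_U`, `U ∋ γ` a compact-open inside `G^r ∖ Ω` on which both characters are constant (Harish-Chandra (M1∀) +
★ ELL-OPEN), the right side vanishes by van Dijk (★ `psTrace_eq_zero_of_forall_classOrbitalIntegral_split_eq_zero`: the orbital integrals of `𝟙_U` at the split regular
classes are `0`, ★ `classOrbitalIntegral_indicator_eq_zero_of_disjoint_hyperbolicSet`) and the left side is `ν(U)(χ_{det}(γ) + χ_{St}(γ))`, `ν(U) > 0` — the proof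
of ★ OPP-23 with its (PS2)∕(NONL2-PAR) binders replaced by the kind-2 JH letter.
* §1 **`char_stG_eq_neg_char_detG_of_jh`** — `∀ γ ∈ G^e, χ_{St_G(ψ)}(γ) = −χ_{ψ∘det_G}(γ)` from the JH letter (`ψ₀` continuous, `St_G(ψ) ≠ ψ∘det_G`,
  `JH(i_G((‖·‖^{1∕2}‖·‖^{1∕2})⁻¹, ψ₀)) = {St_G(ψ), ψ∘det_G}`), binders = the socket's `hns νQv mQv hcanQ 𝔇 hC01 hC05 hE hchar`.
* §2 **`exists_isPseudoCoeff_detG_stG_of_epFunction`** — from `hEP` + the DET pin (`detZ hopen hdet`) + the JH letter: `(∃ f, IsPseudoCoeff (ψ∘det_G) f) ∧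
  (∃ f, IsPseudoCoeff (St_G(ψ)) f ∧ 0 < re f(1) ∧ im f(1) = 0)`.
* §3 **`exists_isPseudoCoeff_detG_stG_of_epFunction_of_eSt`** — §2 for EVERY continuous `ψ`, the DET pin and the JH letter read from the socket's pin `eSt`
  VERBATIM (binder `μZ` = the socket's): the form a by-name payer of #17 calls at a wild place with #21's conclusion as `hEP`.

HONEST LABEL: HC_CM is proved only modulo the 7 printed citations (2 remaining named inputs: hLiu418 = stmt-HodgeConjecture-24832, h413 =
stmt-HodgeConjecture-24833) until rung 0 closes; this file is a `--supports stmt-HodgeConjecture-24833` helper (a rung of #17) and retires nothing by itself.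

## References
* [Rogawski1990] J. D. Rogawski, *Automorphic Representations of Unitary Groups in Three Variables*, Ann. of Math. Stud. 123 (1990), §12.2 (1) p. 173, §12.6
  p. 187, Prop. 12.6.1 (c) p. 188, §12.7 L. 12.7.2 (proof) p. 192, §4.9 Lemma 4.9.2 pp. 55–56.
* [Kottwitz1988] R. E. Kottwitz, *Tamagawa numbers*, Ann. of Math. 127 (1988), §2 Theorem 2.
* [vanDijk1972] G. van Dijk, *Computation of certain induced characters of p-adic groups*, Math. Ann. 199 (1972), Thm. p. 237.
* [Casselman1995] W. Casselman, *Introduction to the theory of admissible representations of p-adic reductive groups* (1995), Cor. 7.1.2.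
-/

set_option autoImplicit false
-- the mandated namespace has the single-problem summit's repeated segment (`HodgeConjecture.HodgeConjecture`)
set_option linter.dupNamespace false

noncomputable section

open NumberField IsDedekindDomain MeasureTheory MeasureTheory.Measure Filter Topology TopologicalSpace Set
open scoped Matrix MatrixGroups Valued
open Literature.NumberTheory.Rogawski1990 Literature.NumberTheory.Rogawski1990.Ch12Sec5
open Literature.NumberTheory.Automorphic Literature.NumberTheory.Automorphic.UnitaryGroup

namespace Summit.HodgeConjecture.HodgeConjecture.Cruxes.H413.K2E3PseudoCoeffExistsEllipticStDetOfEP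

open Summit.HodgeConjecture.HodgeConjecture.Cruxes.H413
open Summit.HodgeConjecture.HodgeConjecture.Cruxes.H413.F0P3cStCharTSTorusDefs
open Summit.HodgeConjecture.HodgeConjecture.Cruxes.H413.F0P3cStCharTSLdsOpp
open Summit.HodgeConjecture.HodgeConjecture.Cruxes.H413.F0P3cStCharTSEPPseudoCoeffStLetters
open Summit.HodgeConjecture.HodgeConjecture.Cruxes.H413.F0P2oU1DisjointOfTower (continuous_units_of_coe)

variable (L : Type) [Field L] [NumberField L] [IsCMField L] (v : HeightOneSpectrum (𝓞 ↥(maximalRealSubfield L)))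

/-! ## §1  `χ_{St_G(ψ)} = −χ_{ψ∘det_G}` on `G^e` from the kind-2 Jordan–Hölder letter -/

set_option maxHeartbeats 1600000 in
set_option synthInstance.maxHeartbeats 400000 in
-- statement-level instance-term unification on the CM local carriers (as ★ OPP-23, same frame)
/-- **`χ_{St_G(ψ)} = −χ_{ψ∘det_G}` ON `G^e`, FROM THE KIND-2 JH LETTER** (print: «observe that `χ_π = −χ_{π′}` on `G^e`» [Rogawski1990, Prop. 12.6.1 (c)
p. 188]; «`χ_π + χ_{π′} = χ_{i_G(χ)}`» [p. 192]) at a §12.5 datum `𝔇` on `U(Φ₃)(L⁺_v)` (`v` non-split): COMPAT `hC01 hC05`, the pin `hE`, (M1∀) `hchar`,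
and the JH letter — a continuous `ψ₀ : E¹_v →* ℂˣ` with `St_G(ψ) ≠ ψ∘det_G` and `JH(i_G((‖·‖^{1∕2}‖·‖^{1∕2})⁻¹, ψ₀)) = {St_G(ψ), ψ∘det_G}` (the shape of the organ's
`eSt` ∕ `hSt`).  Proof: ★ `ps2_kind2_stChar` at `𝟙_U` (`U ∋ γ` compact-open in `G^r ∖ Ω` with both characters constant, ★ ELL-OPEN + (M1∀)), van Dijk's
vanishing ★ `psTrace_eq_zero_of_forall_classOrbitalIntegral_split_eq_zero` ∘ ★ `classOrbitalIntegral_indicator_eq_zero_of_disjoint_hyperbolicSet`, `ν(U) > 0`.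
[cite: Rogawski1990, §12.6 Prop. 12.6.1 (c) p. 188; §12.7 L. 12.7.2 (proof) p. 192; §12.2 (1) p. 173] [cite: vanDijk1972, Thm. p. 237] [cite: Casselman1995, Cor. 7.1.2] -/
theorem char_stG_eq_neg_char_detG_of_jh
    (hns : ∀ w : PlacesOver L v, IsCMField.complexConj L • w.1 = w.1)
    [MeasurableSpace (Gqs L v)] [BorelSpace (Gqs L v)]
    [∀ γ : Gqs L v, MeasurableSpace (Gqs L v ⧸ Subgroup.centralizer ({γ} : Set (Gqs L v)))]
    [∀ γ : Gqs L v, BorelSpace (Gqs L v ⧸ Subgroup.centralizer ({γ} : Set (Gqs L v)))]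
    [MeasurableSpace (Gqs L v ⧸ Subgroup.center (Gqs L v))]
    {H : Type} [Group H] [TopologicalSpace H] [IsTopologicalGroup H] [MeasurableSpace H]
    (νQv : Measure (Gqs L v)) [νQv.IsHaarMeasure] [νQv.IsMulRightInvariant] (mQv : OrbitalMeasureFamily (Gqs L v))
    (hcanQ : mQv.IsCanonical (fun γ => IsRegularElt (γ.val : GL (Fin 3) (UnitaryGroup.LocalRing L v))) νQv)
    (𝔇 : EllipticData (Gqs L v) H) (hC01 : 𝔇.μG = νQv)
    (hC05 : ∀ γ : Gqs L v, γ ∈ 𝔇.regG ↔ IsRegularElt (γ.val : GL (Fin 3) (UnitaryGroup.LocalRing L v)))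
    (hE : ∀ γ : Gqs L v, γ ∈ 𝔇.ellG ↔ IsRegularElt (γ.val : GL (Fin 3) (UnitaryGroup.LocalRing L v)) ∧ γ ∉ hyperbolicSet L v)
    (hchar : ∀ π : IrrClass (Gqs L v), Measurable (𝔇.char π) ∧ LocallyIntegrable (𝔇.char π) 𝔇.μG ∧
      (∀ x ∈ 𝔇.regG, ∀ᶠ y in 𝓝 x, 𝔇.char π y = 𝔇.char π x) ∧
      ∀ φ : Gqs L v → ℂ, IsLocSmooth φ → π.smoothTrace 𝔇.μG φ = ∫ x, φ x * 𝔇.char π x ∂𝔇.μG)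
    {ψ : ↥(Subgroup.center (Gqs L v)) →* ℂˣ}
    (ψ₀ : ↥(normOneUnits (conjLocal L (IsCMField.complexConj L) v)) →* ℂˣ) (hψ₀ : Continuous ψ₀)
    (hne : 𝔇.stG ψ ≠ 𝔇.detG ψ)
    (hJH : ∀ c : IrrClass (Gqs L v),
      c.IsConstituentOf (cmPrincipalSeries L 3 v (cmTorusCharPair L v
        (halfModulusChar (UnitaryGroup.LocalRing L v) * halfModulusChar (UnitaryGroup.LocalRing L v))⁻¹ ψ₀)) ↔ (c = 𝔇.stG ψ ∨ c = 𝔇.detG ψ)) :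
    ∀ γ ∈ 𝔇.ellG, 𝔇.char (𝔇.stG ψ) γ = -𝔇.char (𝔇.detG ψ) γ := by
  intro γ hγ
  obtain ⟨hγreg, hγΩ⟩ := (hE γ).1 hγ
  have hγR : γ ∈ 𝔇.regG := (hC05 γ).2 hγreg
  have hopen := F0P3cStCharTSEllOpen.isOpen_setOf_isRegularElt_and_not_mem_hyperbolicSet L v hns
  -- (M1∀) for the two members
  obtain ⟨-, -, hlc₁, htr₁⟩ := hchar (𝔇.detG ψ)
  obtain ⟨-, -, hlc₂, htr₂⟩ := hchar (𝔇.stG ψ)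
  -- a compact-open `U ∋ γ` inside `G^r ∖ Ω` on which both characters are constant
  have hW : ({g : Gqs L v | IsRegularElt (g.val : GL (Fin 3) (UnitaryGroup.LocalRing L v)) ∧ g ∉ hyperbolicSet L v} ∩
      ({y | 𝔇.char (𝔇.detG ψ) y = 𝔇.char (𝔇.detG ψ) γ} ∩ {y | 𝔇.char (𝔇.stG ψ) y = 𝔇.char (𝔇.stG ψ) γ})) ∈ 𝓝 γ :=
    inter_mem (hopen.mem_nhds ⟨hγreg, hγΩ⟩) (inter_mem (hlc₁ γ hγR) (hlc₂ γ hγR))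
  haveI : TotallyDisconnectedSpace (Gqs L v) := totallyDisconnectedSpace_cmDatum_local L 3 (qsForm L) v
  obtain ⟨O, hOW, hOo, hγO⟩ := mem_nhds_iff.1 hW
  obtain ⟨U, hUc, hUo, hγU, hUO⟩ := Literature.Topology.exists_isCompact_isOpen_mem_subset hOo hγO
  have hUW : U ⊆ _ := hUO.trans hOW
  have hφ : IsLocSmooth (U.indicator fun _ => (1 : ℂ)) := isLocSmooth_indicator hUo hUc.isClosed hUc
  -- `Tr τ(𝟙_U) = ν(U)·χ_τ(γ)` for `τ = ψ∘det_G, St_G(ψ)`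
  have hT : ∀ {τ : IrrClass (Gqs L v)}, (∀ φ : Gqs L v → ℂ, IsLocSmooth φ → τ.smoothTrace 𝔇.μG φ = ∫ x, φ x * 𝔇.char τ x ∂𝔇.μG) →
      (∀ g ∈ U, 𝔇.char τ g = 𝔇.char τ γ) → τ.smoothTrace νQv (U.indicator fun _ => (1 : ℂ)) = (νQv.real U : ℂ) * 𝔇.char τ γ := by
    intro τ htr hcst
    rw [← hC01, htr _ hφ, hC01]
    exact F0P3cStCharTSCasselmanCap.integral_indicator_mul_eq_of_eqOn νQv hUo.measurableSet _ γ hcst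
  have h1 : (𝔇.detG ψ).smoothTrace νQv (U.indicator fun _ => (1 : ℂ)) = (νQv.real U : ℂ) * 𝔇.char (𝔇.detG ψ) γ :=
    hT htr₁ fun g hg => (hUW hg).2.1
  have h2 : (𝔇.stG ψ).smoothTrace νQv (U.indicator fun _ => (1 : ℂ)) = (νQv.real U : ℂ) * 𝔇.char (𝔇.stG ψ) γ :=
    hT htr₂ fun g hg => (hUW hg).2.2
  -- van Dijk: `Tr i_G(χ)(𝟙_U) = 0` — the orbital integrals of `𝟙_U` vanish at the regular split classes (`U ∩ Ω = ∅`)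
  have hc1 : Continuous ((halfModulusChar (UnitaryGroup.LocalRing L v) * halfModulusChar (UnitaryGroup.LocalRing L v))⁻¹ :
      (UnitaryGroup.LocalRing L v)ˣ → ℂˣ) :=
    continuous_units_of_coe _ (F0P3cStCharTSStChar.continuous_stFst L v)
  have h0 : Representation.smoothTrace (G := Gqs L v)
      (cmPrincipalSeries L 3 v (cmTorusCharPair L v
        (halfModulusChar (UnitaryGroup.LocalRing L v) * halfModulusChar (UnitaryGroup.LocalRing L v))⁻¹ ψ₀)) νQv (U.indicator fun _ => (1 : ℂ)) = 0 :=
    psTrace_eq_zero_of_forall_classOrbitalIntegral_split_eq_zero L v hns νQv mQv hcanQ _ hφ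
      (fun t ht => classOrbitalIntegral_indicator_eq_zero_of_disjoint_hyperbolicSet L v mQv (fun g hg => (hUW hg).1.2) t ht)
      ⟨(halfModulusChar (UnitaryGroup.LocalRing L v) * halfModulusChar (UnitaryGroup.LocalRing L v))⁻¹, ψ₀⟩ hc1 hψ₀
  -- the kind-2 JH letter at `𝟙_U`: `Tr ψ∘det_G(𝟙_U) + Tr St_G(ψ)(𝟙_U) = Tr i_G(χ)(𝟙_U)`
  have hid := F0P3cStCharTSPs2Kind2.ps2_kind2_stChar L v hns νQv ψ₀ hψ₀ (π₁ := 𝔇.detG ψ) (πSt := 𝔇.stG ψ) hne.symm hJH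
    (U.indicator fun _ => (1 : ℂ))
  rw [h1, h2, h0, ← mul_add, mul_eq_zero] at hid
  -- `ν(U) > 0`
  have hpos : (νQv.real U : ℂ) ≠ 0 := by
    have hp : 0 < νQv.real U :=
      ENNReal.toReal_pos (hUo.measure_pos νQv ⟨γ, hγU⟩).ne' hUc.measure_lt_top.ne
    exact_mod_cast hp.ne'
  exact eq_neg_of_add_eq_zero_right (hid.resolve_left hpos)

/-! ## §2  Pseudo-coefficients of `ψ∘det_G` and `St_G(ψ)` from an Euler–Poincaré function by shape -/

set_option maxHeartbeats 1600000 in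
set_option synthInstance.maxHeartbeats 400000 in
-- statement-level instance-term unification on the CM local carriers (as §1)
/-- **THE KIND-2 CLASSES HAVE PSEUDO-COEFFICIENTS AT ANY NON-SPLIT PLACE CARRYING AN EULER–POINCARÉ FUNCTION BY SHAPE.**  Binders: the socket's `hns νQv mQv
hcanQ 𝔇 hC01 hC04 hC05 hE hchar`; `hEP` = the eight clauses (conclusion of ★ (G3) ∕ ★ (G3)-RAM ∕ socket #21 `sig_K2E3EPFunctionGWild`, token for token); the
character `ψ` of the centre with the DET pin `detZ hopen hdet` (letter `eSt`); the kind-2 JH letter `ψ₀ hψ₀ hne hJH` (letter `eSt` ∕ `hSt`).  Conclusion: `ψ∘det_G` has a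
pseudo-coefficient (★ FILE B `exists_isPseudoCoeff_detG_of_epFunction`) and `St_G(ψ)` has one with `f(1)` a positive real (★ FILE B `exists_isPseudoCoeff_stG_of_epFunction`,
its `hOpp` supplied by §1). [cite: Rogawski1990, §12.6 p. 187; Prop. 12.6.1 (c) p. 188] [cite: Kottwitz1988, §2 Theorem 2] -/
theorem exists_isPseudoCoeff_detG_stG_of_epFunction
    (hns : ∀ w : PlacesOver L v, IsCMField.complexConj L • w.1 = w.1)
    [MeasurableSpace (Gqs L v)] [BorelSpace (Gqs L v)]
    [∀ γ : Gqs L v, MeasurableSpace (Gqs L v ⧸ Subgroup.centralizer ({γ} : Set (Gqs L v)))]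
    [∀ γ : Gqs L v, BorelSpace (Gqs L v ⧸ Subgroup.centralizer ({γ} : Set (Gqs L v)))]
    [MeasurableSpace (Gqs L v ⧸ Subgroup.center (Gqs L v))]
    {H : Type} [Group H] [TopologicalSpace H] [IsTopologicalGroup H] [MeasurableSpace H]
    (νQv : Measure (Gqs L v)) [νQv.IsHaarMeasure] [νQv.IsMulRightInvariant] (mQv : OrbitalMeasureFamily (Gqs L v))
    (hcanQ : mQv.IsCanonical (fun γ => IsRegularElt (γ.val : GL (Fin 3) (UnitaryGroup.LocalRing L v))) νQv)
    (𝔇 : EllipticData (Gqs L v) H) (hC01 : 𝔇.μG = νQv) (hC04 : 𝔇.orb = mQv)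
    (hC05 : ∀ γ : Gqs L v, γ ∈ 𝔇.regG ↔ IsRegularElt (γ.val : GL (Fin 3) (UnitaryGroup.LocalRing L v)))
    (hE : ∀ γ : Gqs L v, γ ∈ 𝔇.ellG ↔ IsRegularElt (γ.val : GL (Fin 3) (UnitaryGroup.LocalRing L v)) ∧ γ ∉ hyperbolicSet L v)
    (hchar : ∀ π : IrrClass (Gqs L v), Measurable (𝔇.char π) ∧ LocallyIntegrable (𝔇.char π) 𝔇.μG ∧
      (∀ x ∈ 𝔇.regG, ∀ᶠ y in 𝓝 x, 𝔇.char π y = 𝔇.char π x) ∧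
      ∀ φ : Gqs L v → ℂ, IsLocSmooth φ → π.smoothTrace 𝔇.μG φ = ∫ x, φ x * 𝔇.char π x ∂𝔇.μG)
    -- ══ the Euler–Poincaré function BY SHAPE (conclusion of (G3) ∕ (G3)-RAM ∕ #21, token for token) ══
    (hEP : ∃ fG : Gqs L v → ℂ, IsLocSmooth fG ∧ Measurable fG ∧ Integrable fG νQv ∧ ∫ g, fG g ∂νQv = 1 ∧
      (fG 1).im = 0 ∧ (fG 1).re < 0 ∧
      (∀ γ : Gqs L v, IsRegularElt (γ.val : GL (Fin 3) (UnitaryGroup.LocalRing L v)) →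
        IsCompact ((Subgroup.centralizer ({γ} : Set (Gqs L v))) : Set (Gqs L v)) → classOrbitalIntegral mQv fG (ConjClasses.mk γ) = 1) ∧
      (∀ γ : Gqs L v, IsRegularElt (γ.val : GL (Fin 3) (UnitaryGroup.LocalRing L v)) →
        ¬ IsCompact ((Subgroup.centralizer ({γ} : Set (Gqs L v))) : Set (Gqs L v)) → classOrbitalIntegral mQv fG (ConjClasses.mk γ) = 0))
    -- ══ the character `ψ` of the centre, its DET pin and its kind-2 JH letter ══
    {ψ : ↥(Subgroup.center (Gqs L v)) →* ℂˣ} (detZ : Gqs L v →* ↥(Subgroup.center (Gqs L v)))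
    (hopen : IsOpen (((ψ.comp detZ).ker : Subgroup (Gqs L v)) : Set (Gqs L v)))
    (hdet : 𝔇.detG ψ = IrrClass.mk (SmoothIrrep.ofChar (ψ.comp detZ) hopen))
    (ψ₀ : ↥(normOneUnits (conjLocal L (IsCMField.complexConj L) v)) →* ℂˣ) (hψ₀ : Continuous ψ₀)
    (hne : 𝔇.stG ψ ≠ 𝔇.detG ψ)
    (hJH : ∀ c : IrrClass (Gqs L v),
      c.IsConstituentOf (cmPrincipalSeries L 3 v (cmTorusCharPair L v
        (halfModulusChar (UnitaryGroup.LocalRing L v) * halfModulusChar (UnitaryGroup.LocalRing L v))⁻¹ ψ₀)) ↔ (c = 𝔇.stG ψ ∨ c = 𝔇.detG ψ)) :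
    (∃ f : Gqs L v → ℂ, 𝔇.IsPseudoCoeff (𝔇.detG ψ) f) ∧
      (∃ f : Gqs L v → ℂ, 𝔇.IsPseudoCoeff (𝔇.stG ψ) f ∧ 0 < (f 1).re ∧ (f 1).im = 0) :=
  ⟨exists_isPseudoCoeff_detG_of_epFunction L v hns νQv mQv 𝔇 hC01 hC04 hC05 hE hchar hEP ψ detZ hopen hdet,
    exists_isPseudoCoeff_stG_of_epFunction L v hns νQv mQv 𝔇 hC01 hC04 hC05 hE hchar hEP ψ detZ hopen hdet
      (char_stG_eq_neg_char_detG_of_jh L v hns νQv mQv hcanQ 𝔇 hC01 hC05 hE hchar ψ₀ hψ₀ hne hJH)⟩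

/-! ## §3  The same for every continuous `ψ`, the letters read from the socket's pin `eSt` verbatim -/

set_option maxHeartbeats 1600000 in
set_option synthInstance.maxHeartbeats 400000 in
-- statement-level instance-term unification on the CM local carriers (as §1)
/-- **THE KIND-2 PART OF #17 AT ANY NON-SPLIT PLACE WITH AN EULER–POINCARÉ FUNCTION, LETTERS FROM THE PIN `eSt`.**  Binders: the socket's `hns νQv mQv hcanQ`,
its `μZ`, `𝔇` and pins `hC01 hC04 hC05 hE hchar`; `hEP` (eight clauses: ★ (G3) ∕ ★ (G3)-RAM ∕ socket #21); the socket's last pin `eSt` VERBATIM (`ι_Z`, `det_Z`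
and, for every continuous `ψ`, the DET pin, `St_G(ψ) ≠ ψ∘det_G`, the JH list, the `L²` flags).  For every continuous character `ψ` of the centre: `ψ∘det_G` and
`St_G(ψ)` have pseudo-coefficients, the latter with `f(1)` a positive real (§2 at `ψ₀ := ψ ∘ ι_Z`).  A by-name payer of #17 at a WILD place calls this with
#21's conclusion as `hEP`. [cite: Rogawski1990, §12.6 p. 187; §12.2 (1) p. 173] [cite: Kottwitz1988, §2 Theorem 2] -/
theorem exists_isPseudoCoeff_detG_stG_of_epFunction_of_eSt
    (hns : ∀ w : PlacesOver L v, IsCMField.complexConj L • w.1 = w.1)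
    [MeasurableSpace (Gqs L v)] [BorelSpace (Gqs L v)]
    [∀ γ : Gqs L v, MeasurableSpace (Gqs L v ⧸ Subgroup.centralizer ({γ} : Set (Gqs L v)))]
    [∀ γ : Gqs L v, BorelSpace (Gqs L v ⧸ Subgroup.centralizer ({γ} : Set (Gqs L v)))]
    [MeasurableSpace (Gqs L v ⧸ Subgroup.center (Gqs L v))]
    {H : Type} [Group H] [TopologicalSpace H] [IsTopologicalGroup H] [MeasurableSpace H]
    (νQv : Measure (Gqs L v)) [νQv.IsHaarMeasure] [νQv.IsMulRightInvariant] (mQv : OrbitalMeasureFamily (Gqs L v))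
    (hcanQ : mQv.IsCanonical (fun γ => IsRegularElt (γ.val : GL (Fin 3) (UnitaryGroup.LocalRing L v))) νQv)
    (μZ : Measure (Gqs L v ⧸ Subgroup.center (Gqs L v)))
    (𝔇 : EllipticData (Gqs L v) H) (hC01 : 𝔇.μG = νQv) (hC04 : 𝔇.orb = mQv)
    (hC05 : ∀ γ : Gqs L v, γ ∈ 𝔇.regG ↔ IsRegularElt (γ.val : GL (Fin 3) (UnitaryGroup.LocalRing L v)))
    (hE : ∀ γ : Gqs L v, γ ∈ 𝔇.ellG ↔ IsRegularElt (γ.val : GL (Fin 3) (UnitaryGroup.LocalRing L v)) ∧ γ ∉ hyperbolicSet L v)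
    (hchar : ∀ π : IrrClass (Gqs L v), Measurable (𝔇.char π) ∧ LocallyIntegrable (𝔇.char π) 𝔇.μG ∧
      (∀ x ∈ 𝔇.regG, ∀ᶠ y in 𝓝 x, 𝔇.char π y = 𝔇.char π x) ∧
      ∀ φ : Gqs L v → ℂ, IsLocSmooth φ → π.smoothTrace 𝔇.μG φ = ∫ x, φ x * 𝔇.char π x ∂𝔇.μG)
    (hEP : ∃ fG : Gqs L v → ℂ, IsLocSmooth fG ∧ Measurable fG ∧ Integrable fG νQv ∧ ∫ g, fG g ∂νQv = 1 ∧
      (fG 1).im = 0 ∧ (fG 1).re < 0 ∧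
      (∀ γ : Gqs L v, IsRegularElt (γ.val : GL (Fin 3) (UnitaryGroup.LocalRing L v)) →
        IsCompact ((Subgroup.centralizer ({γ} : Set (Gqs L v))) : Set (Gqs L v)) → classOrbitalIntegral mQv fG (ConjClasses.mk γ) = 1) ∧
      (∀ γ : Gqs L v, IsRegularElt (γ.val : GL (Fin 3) (UnitaryGroup.LocalRing L v)) →
        ¬ IsCompact ((Subgroup.centralizer ({γ} : Set (Gqs L v))) : Set (Gqs L v)) → classOrbitalIntegral mQv fG (ConjClasses.mk γ) = 0))
    -- ══ the socket's pin `eSt`, VERBATIM ══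
    (eSt : ∃ (ιZ : ↥(normOneUnits (conjLocal L (IsCMField.complexConj L) v)) →* ↥(Subgroup.center (Gqs L v))) (detZ : (Gqs L v) →* ↥(Subgroup.center (Gqs L v))), Continuous ιZ ∧ Continuous detZ ∧ (∀ z : ↥(normOneUnits (conjLocal L (IsCMField.complexConj L) v)), ((ιZ z).val.val.val : Matrix (Fin 3) (Fin 3) (UnitaryGroup.LocalRing L v)) = (((z : (UnitaryGroup.LocalRing L v)ˣ) : UnitaryGroup.LocalRing L v)) • (1 : Matrix (Fin 3) (Fin 3) (UnitaryGroup.LocalRing L v))) ∧ (∀ g : (Gqs L v), ((detZ g).val.val.val : Matrix (Fin 3) (Fin 3) (UnitaryGroup.LocalRing L v)) = (g.val.val : Matrix (Fin 3) (Fin 3) (UnitaryGroup.LocalRing L v)).det • (1 : Matrix (Fin 3) (Fin 3) (UnitaryGroup.LocalRing L v))) ∧ ∀ ψ : ↥(Subgroup.center (Gqs L v)) →* ℂˣ, Continuous ψ → (∃ hopen : IsOpen (((ψ.comp detZ).ker : Subgroup (Gqs L v)) : Set (Gqs L v)), 𝔇.detG ψ = IrrClass.mk (SmoothIrrep.ofChar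 (ψ.comp detZ) hopen)) ∧ 𝔇.stG ψ ≠ 𝔇.detG ψ ∧ (∀ c : IrrClass (Gqs L v), c.IsConstituentOf (cmPrincipalSeries L 3 v (cmTorusCharPair L v (halfModulusChar (UnitaryGroup.LocalRing L v) * halfModulusChar (UnitaryGroup.LocalRing L v))⁻¹ (ψ.comp ιZ))) ↔ (c = 𝔇.stG ψ ∨ c = 𝔇.detG ψ)) ∧ (𝔇.stG ψ).IsSquareIntegrable μZ ∧ ¬ (𝔇.detG ψ).IsSquareIntegrable μZ) :
    ∀ ψ : ↥(Subgroup.center (Gqs L v)) →* ℂˣ, Continuous ψ →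
      (∃ f : Gqs L v → ℂ, 𝔇.IsPseudoCoeff (𝔇.detG ψ) f) ∧
        (∃ f : Gqs L v → ℂ, 𝔇.IsPseudoCoeff (𝔇.stG ψ) f ∧ 0 < (f 1).re ∧ (f 1).im = 0) := by
  intro ψ hψ
  obtain ⟨ιZ, detZ, hιZ, -, -, -, hall⟩ := eSt
  obtain ⟨⟨hopen, hdet⟩, hne, hJH, -, -⟩ := hall ψ hψ
  exact exists_isPseudoCoeff_detG_stG_of_epFunction L v hns νQv mQv hcanQ 𝔇 hC01 hC04 hC05 hE hchar hEP detZ hopen hdet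
    (ψ.comp ιZ) (hψ.comp hιZ) hne hJH

end Summit.HodgeConjecture.HodgeConjecture.Cruxes.H413.K2E3PseudoCoeffExistsEllipticStDetOfEP

end
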